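import Summits.HubbardSuperconductivity.HubbardSuperconductivity.Theorems.AnisotropyChordStiffnessDiamagnetic
import Summits.HubbardSuperconductivity.HubbardSuperconductivity.Theorems.AnisotropyChordStiffnessVariational

/-!
# Route `AnisotropyChord` / H0 rotor rung: THE TWIST STIFFNESS IS THE WINDING CONDUCTANCE OF THE DOOB CONFIGURATION
# NETWORK (port of theory seat `hubbard-h0-rotor-theory-1`, cycle 10, `Sketch10.lean` Parts A–E, memo ROTOR-THEORY-10
# §137; work-order v8)

For a stoquastic `H(Δ)` and a Perron sector amplitude `ψ = a ≥ 0` the configuration graph of the sector (vertices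
`σ`, edges = single nearest-neighbour hops `σ ↔ σ∘swap_{x,x+eᵢ}`) carries the DOOB CONDUCTANCES
`c(σ, σ') = ¼ a(σ) a(σ')`.  The uniform current `J^j_0` is `i ×` a real antisymmetric hop matrix, so in the variational
characterisation of `m₋₁(J^j_0)` the optimal test vector is PURELY IMAGINARY relative to `ψ`, `φ = i g ψ` with `g`
real, and by the ground-state transform (`xxz_groundStateTransform`)

  `⟨−T_j⟩ − 2 m₋₁(J^j_0) = 2 · min_{g : Ω → ℝ} W_j(a; g)`,
  `W_j(a; g) := Σ_{directed bonds (x,i)} ¼ Σ_{σ flippable} a(σ)a(σ') (g(σ') − g(σ) − [i = j]·s_{x,i}(σ))²`,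

`s = ±1` the orientation of the hop across the bond (the unit winding cocycle): the twist (Drude/helicity) stiffness
`Υ^j L² = ⟨−T_j⟩ − 2m₋₁(J^j_0)` is TWICE THE MINIMAL DIRICHLET ENERGY OF A UNIT WINDING COCYCLE on the Doob network —
its effective winding conductance (Dirichlet principle; finite-volume `T = 0` stoquastic instance of the variational
conductivity formula for reversible lattice gases, Kipnis–Landim 1999 eq. (7.0.7) / Spohn 1991 Prop. II.2.2).

* Part A: `orient`, `bondWinding`, `bondDirichlet`, `bondPairing`, `bondMass`, `windingEnergy`, `dirichletEnergy`,
  `windingPairing`; the hypotheses `DoobWindingStiffness Δ M` / `DoobWindingStiffnessN Δ M` ((S_tw) in network form);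
* Part B–C: `bondWinding_expand`, `sum_bondMass_eq`, **`windingEnergy_expand`** (`W_j(g) = Q(g) + 2 B_j(g) + ½⟨−T_j⟩`),
  `sum_bond_eq_sum_edge` (bonds = edges for `L ≥ 3`), **`dirichlet_eq_shiftedForm`** (`Q(g) = Re⟨i g ψ, (H − E₀) i g ψ⟩`);
* Part D: **`currentForm_eq_pairing`** (`⟨i g ψ, J^j_0 ψ⟩ = −i B_j(g)`), `imagTest_mem_spinZSector`;
* Part E: **`windingEnergy_ge`** (φ-form twist stiffness at level `Υ` ⇒ `Υ/2 ≤ W_j(a; g)` for EVERY real `g`) and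
  **`doobWindingStiffness_of_variational`** : `VariationalTwistStiffness Δ M → DoobWindingStiffness Δ M` (+ `N` twin).
The converse (exact dictionary `DoobWindingStiffness ↔ VariationalTwistStiffness`) is the companion file
`…StiffnessDoobDictionary`.  Typing/proof authority: theory seat `hubbard-h0-rotor-theory-1`, cycle 10.
-/

set_option linter.dupNamespace false

noncomputable section

open Matrix Complex Finset Filter Topology
open scoped ComplexConjugate
open Literature.MathematicalPhysics.QuantumLattice hiding torusPhase torusNorm
open Literature.Probability.LatticeModels
open Summit.HubbardSuperconductivity.HubbardSuperconductivity.Theorems.AnisotropyChord.InsertionEntropy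
  (torusPhase norm_torusPhase IsPerronSectorGroundAmplitude)
open Summit.HubbardSuperconductivity.HubbardSuperconductivity.Theorems.AnisotropyChord.Stiffness

namespace Summit.HubbardSuperconductivity.HubbardSuperconductivity.Theorems.AnisotropyChord.Stiffness.Doob

variable {L : ℕ} [NeZero L]

/-! ## A. The network objects -/

omit [NeZero L] in
/-- Orientation `s_{xy}(σ) ∈ {+1, −1, 0}` of configuration `σ` across the directed bond `(x, y)`: `+1` if
`(σ_x, σ_y) = (0,1)`, `−1` if `(1,0)`, `0` if the bond is not flippable (twice the tree's current
coefficient `c_σ = ±½`). [folklore] -/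
def orient (x y : TorusSite 2 L) (σ : TensorIndex (TorusSite 2 L) 2) : ℝ :=
  if σ x = 0 ∧ σ y = 1 then 1 else if σ x = 1 ∧ σ y = 0 then -1 else 0

/-- Per-bond WINDING ENERGY with drive `t`: `¼ Σ_{σ flippable} a a' (g' − g − t s(σ))²`. [folklore] -/
def bondWinding (a : TensorIndex (TorusSite 2 L) 2 → ℝ) (x y : TorusSite 2 L) (t : ℝ)
    (g : TensorIndex (TorusSite 2 L) 2 → ℝ) : ℝ :=
  (1 / 4 : ℝ) * ∑ σ, (if σ x ≠ σ y then
    a σ * a (σ ∘ Equiv.swap x y) * (g (σ ∘ Equiv.swap x y) - g σ - t * orient x y σ) ^ 2 else 0)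

/-- Per-bond DIRICHLET ENERGY `¼ Σ_{σ flippable} a a' (g − g')²` (Doob conductances `¼ a a'`). [folklore] -/
def bondDirichlet (a : TensorIndex (TorusSite 2 L) 2 → ℝ) (x y : TorusSite 2 L)
    (g : TensorIndex (TorusSite 2 L) 2 → ℝ) : ℝ :=
  (1 / 4 : ℝ) * ∑ σ, (if σ x ≠ σ y then a σ * a (σ ∘ Equiv.swap x y) * (g σ - g (σ ∘ Equiv.swap x y)) ^ 2 else 0)

/-- Per-bond WINDING PAIRING `B_{xy}(g) = ¼ Σ_σ s(σ) (g − g') a a'` (the flux of `dg` across the bond). [folklore] -/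
def bondPairing (a : TensorIndex (TorusSite 2 L) 2 → ℝ) (x y : TorusSite 2 L)
    (g : TensorIndex (TorusSite 2 L) 2 → ℝ) : ℝ :=
  (1 / 4 : ℝ) * ∑ σ, orient x y σ * (g σ - g (σ ∘ Equiv.swap x y)) * (a σ * a (σ ∘ Equiv.swap x y))

/-- Per-bond MASS `¼ Σ_{σ flippable} a a'` (`= ½ Re⟨ψ, K_{xy} ψ⟩`). [folklore] -/
def bondMass (a : TensorIndex (TorusSite 2 L) 2 → ℝ) (x y : TorusSite 2 L) : ℝ :=
  (1 / 4 : ℝ) * ∑ σ, (if σ x ≠ σ y then a σ * a (σ ∘ Equiv.swap x y) else 0)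

/-- **THE WINDING ENERGY `W_j(a; g)`** of a real potential `g` on the Doob network of `a`, driven by the unit
winding cocycle of axis `j` (drive `1` on the `j`-bonds, `0` on the others). [folklore] -/
def windingEnergy (a : TensorIndex (TorusSite 2 L) 2 → ℝ) (j : Fin 2)
    (g : TensorIndex (TorusSite 2 L) 2 → ℝ) : ℝ :=
  ∑ p : TorusSite 2 L × Fin 2, bondWinding a p.1 (p.1 + Pi.single p.2 1) (if p.2 = j then 1 else 0) g

/-- Total Dirichlet energy `Q(a; g) = Σ_{bonds} ¼ Σ_{flip} a a' (g − g')²`. [folklore] -/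
def dirichletEnergy (a : TensorIndex (TorusSite 2 L) 2 → ℝ) (g : TensorIndex (TorusSite 2 L) 2 → ℝ) : ℝ :=
  ∑ p : TorusSite 2 L × Fin 2, bondDirichlet a p.1 (p.1 + Pi.single p.2 1) g

/-- Total winding pairing of axis `j`: `B_j(a; g) = Σ_x B_{x,x+e_j}(g)`. [folklore] -/
def windingPairing (a : TensorIndex (TorusSite 2 L) 2 → ℝ) (j : Fin 2)
    (g : TensorIndex (TorusSite 2 L) 2 → ℝ) : ℝ :=
  ∑ x : TorusSite 2 L, bondPairing a x (x + Pi.single j 1) g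

/-- **HYPOTHESIS (S_tw) IN NETWORK LANGUAGE — `DoobWindingStiffness Δ M`:** there is `Υ₀ > 0` such that,
eventually in `L`, for the Perron amplitude `a` of sector `M_L − 1`, each axis `j` and EVERY real potential
`g` on configurations, `½ Υ₀ L² ≤ W_j(a; g)`: no corrector can screen the unit winding drive below
`½Υ₀L²` — the Doob configuration network has winding conductance `≥ ½Υ₀L²` on both axes.
[conjecture: theory seat hubbard-h0-rotor-theory-1, cycle 10, 2026-08-28 — hypothesis (S_tw) of H0, network form; implied by `VariationalTwistStiffness` (`doobWindingStiffness_of_variational`)] -/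
def DoobWindingStiffness (Δ : ℝ) (M : ℕ → ℝ) : Prop :=
  ∃ Υ₀ > (0 : ℝ), ∀ᶠ L : ℕ in atTop, ∀ [NeZero L],
    ∀ a : TensorIndex (TorusSite 2 L) 2 → ℝ, IsPerronSectorGroundAmplitude L Δ (M L - 1) a →
      ∀ (j : Fin 2) (g : TensorIndex (TorusSite 2 L) 2 → ℝ), Υ₀ * (L : ℝ) ^ 2 / 2 ≤ windingEnergy a j g

/-- The `N`-sector twin (sector `M_L`; one-state chain of cycle 9). [conjecture: theory seat hubbard-h0-rotor-theory-1, cycle 10, 2026-08-28 — hypothesis (S_tw)^N of H0, network form] -/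
def DoobWindingStiffnessN (Δ : ℝ) (M : ℕ → ℝ) : Prop :=
  ∃ Υ₀ > (0 : ℝ), ∀ᶠ L : ℕ in atTop, ∀ [NeZero L],
    ∀ a : TensorIndex (TorusSite 2 L) 2 → ℝ, IsPerronSectorGroundAmplitude L Δ (M L) a →
      ∀ (j : Fin 2) (g : TensorIndex (TorusSite 2 L) 2 → ℝ), Υ₀ * (L : ℝ) ^ 2 / 2 ≤ windingEnergy a j g

/-! ## B. Per-bond algebra -/

omit [NeZero L] in
/-- On a flippable configuration the orientation is `±1`, so `s² = 1`. [folklore] -/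
theorem orient_sq {x y : TorusSite 2 L} {σ : TensorIndex (TorusSite 2 L) 2} (h : σ x ≠ σ y) :
    orient x y σ ^ 2 = 1 := by
  unfold orient
  have fin2 : ∀ t : Fin 2, t = 0 ∨ t = 1 := by decide
  rcases fin2 (σ x) with hx | hx <;> rcases fin2 (σ y) with hy | hy
  · exact absurd (hx.trans hy.symm) h
  · simp [hx, hy]
  · simp [hx, hy]
  · exact absurd (hx.trans hy.symm) h

omit [NeZero L] in
/-- On a non-flippable configuration the orientation vanishes. [folklore] -/
theorem orient_eq_zero {x y : TorusSite 2 L} {σ : TensorIndex (TorusSite 2 L) 2} (h : σ x = σ y) :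
    orient x y σ = 0 := by
  unfold orient
  have fin2 : ∀ t : Fin 2, t = 0 ∨ t = 1 := by decide
  rcases fin2 (σ x) with hx | hx <;> rcases fin2 (σ y) with hy | hy <;> simp_all

/-- **Per-bond expansion:** `W_{xy}(t; g) = Q_{xy}(g) + 2 t B_{xy}(g) + t² k_{xy}`. [folklore] -/
theorem bondWinding_expand (a : TensorIndex (TorusSite 2 L) 2 → ℝ) (x y : TorusSite 2 L) (t : ℝ)
    (g : TensorIndex (TorusSite 2 L) 2 → ℝ) :
    bondWinding a x y t g = bondDirichlet a x y g + 2 * t * bondPairing a x y g + t ^ 2 * bondMass a x y := by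
  unfold bondWinding bondDirichlet bondPairing bondMass
  rw [show 2 * t * ((1 / 4 : ℝ) * ∑ σ, orient x y σ * (g σ - g (σ ∘ Equiv.swap x y))
        * (a σ * a (σ ∘ Equiv.swap x y)))
      = (1 / 4 : ℝ) * ∑ σ, 2 * t * (orient x y σ * (g σ - g (σ ∘ Equiv.swap x y))
        * (a σ * a (σ ∘ Equiv.swap x y))) by rw [Finset.mul_sum, Finset.mul_sum, Finset.mul_sum]; ring_nf,
    show t ^ 2 * ((1 / 4 : ℝ) * ∑ σ, (if σ x ≠ σ y then a σ * a (σ ∘ Equiv.swap x y) else 0))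
      = (1 / 4 : ℝ) * ∑ σ, t ^ 2 * (if σ x ≠ σ y then a σ * a (σ ∘ Equiv.swap x y) else 0) by
        rw [Finset.mul_sum, Finset.mul_sum, Finset.mul_sum]; ring_nf,
    ← mul_add, ← mul_add, ← Finset.sum_add_distrib, ← Finset.sum_add_distrib]
  congr 1
  refine Finset.sum_congr rfl fun σ _ => ?_
  by_cases h : σ x ≠ σ y
  · rw [if_pos h, if_pos h, if_pos h]
    have hs := orient_sq (x := x) (y := y) (σ := σ) h
    have key : (g (σ ∘ Equiv.swap x y) - g σ - t * orient x y σ) ^ 2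
        = (g σ - g (σ ∘ Equiv.swap x y)) ^ 2
          + 2 * t * (orient x y σ * (g σ - g (σ ∘ Equiv.swap x y))) + t ^ 2 := by
      have e : (g (σ ∘ Equiv.swap x y) - g σ - t * orient x y σ) ^ 2
          = (g σ - g (σ ∘ Equiv.swap x y)) ^ 2
            + 2 * t * (orient x y σ * (g σ - g (σ ∘ Equiv.swap x y))) + t ^ 2 * orient x y σ ^ 2 := by ring
      rw [e, hs, mul_one]
    rw [key]; ring
  · rw [if_neg h, if_neg h, if_neg h, orient_eq_zero (not_not.mp h)]
    ring

/-! ## C. Global identities: expansion, bonds = edges, the Dirichlet energy as the shifted form -/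

/-- `Σ_x k_{x,x+e_j} = ½ ⟨ψ, (−T_j) ψ⟩` (`L ≥ 2`). [folklore] -/
theorem sum_bondMass_eq (hL : 2 ≤ L) (a : TensorIndex (TorusSite 2 L) 2 → ℝ) (j : Fin 2) :
    ∑ x : TorusSite 2 L, bondMass a x (x + Pi.single j 1) = (1 / 2 : ℝ) * kineticExpect L a j := by
  unfold kineticExpect
  rw [kineticForm_sum, Complex.re_sum, Finset.mul_sum]
  refine Finset.sum_congr rfl fun x _ => ?_
  have hxy : x ≠ x + Pi.single j 1 := Ne.symm (add_single_ne_self hL x j)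
  unfold toC
  rw [kineticBondForm_eq hxy a]
  unfold bondMass
  rw [Finset.mul_sum, Finset.mul_sum]
  refine Finset.sum_congr rfl fun σ _ => ?_
  split_ifs <;> ring

/-- **EXPANSION OF THE WINDING ENERGY:** `W_j(g) = Q(g) + 2 B_j(g) + ½⟨−T_j⟩` (`L ≥ 2`). [folklore] -/
theorem windingEnergy_expand (hL : 2 ≤ L) (a : TensorIndex (TorusSite 2 L) 2 → ℝ) (j : Fin 2)
    (g : TensorIndex (TorusSite 2 L) 2 → ℝ) :
    windingEnergy a j g = dirichletEnergy a g + 2 * windingPairing a j g + (1 / 2 : ℝ) * kineticExpect L a j := by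
  unfold windingEnergy dirichletEnergy windingPairing
  simp only [bondWinding_expand]
  rw [Finset.sum_add_distrib, Finset.sum_add_distrib]
  congr 1
  · congr 1
    rw [Fintype.sum_prod_type, Finset.mul_sum]
    refine Finset.sum_congr rfl fun x _ => ?_
    rw [Fin.sum_univ_two]
    fin_cases j <;> simp
  · rw [← sum_bondMass_eq hL a j, Fintype.sum_prod_type]
    refine Finset.sum_congr rfl fun x _ => ?_
    rw [Fin.sum_univ_two]
    fin_cases j <;> simp

/-- **Bonds = edges for `L ≥ 3`:** `Σ_{(x,i)} G{x, x+eᵢ} = Σ_{e ∈ E} G e` (the directed bonds `(x,i)` enumerate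
the edges of the torus graph exactly once). [folklore] -/
theorem sum_bond_eq_sum_edge (hL : 3 ≤ L) (G : Sym2 (TorusSite 2 L) → ℝ) :
    ∑ p : TorusSite 2 L × Fin 2, G s(p.1, p.1 + Pi.single p.2 1)
      = ∑ e ∈ (torusGraph 2 L).edgeFinset, G e := by
  classical
  rw [← Finset.sum_image (f := G)
    (s := (Finset.univ : Finset (TorusSite 2 L × Fin 2)))
    (g := fun p : TorusSite 2 L × Fin 2 => (s(p.1, p.1 + Pi.single p.2 1) : Sym2 (TorusSite 2 L)))
    (fun p _ q _ h => bond_injective hL h)]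
  congr 1
  ext e
  rw [Finset.mem_image]
  constructor
  · rintro ⟨p, -, rfl⟩
    exact bond_mem_edgeFinset (by omega) p.1 p.2
  · intro he
    induction e using Sym2.ind with
    | h x y =>
      rw [SimpleGraph.mem_edgeFinset, SimpleGraph.mem_edgeSet] at he
      obtain ⟨-, ⟨i, hy⟩ | ⟨i, hx⟩⟩ := (torusGraph_adj_iff x y).mp he
      · exact ⟨(x, i), Finset.mem_univ _, by rw [hy]⟩
      · exact ⟨(y, i), Finset.mem_univ _, by rw [hx, Sym2.eq_swap]⟩

/-- `|i g − i g'|² = (g − g')²` for real `g, g'`. [folklore] -/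
theorem norm_I_mul_sub_sq (r r' : ℝ) : ‖I * (r : ℂ) - I * (r' : ℂ)‖ ^ 2 = (r - r') ^ 2 := by
  rw [← mul_sub, norm_mul, Complex.norm_I, one_mul, ← Complex.ofReal_sub, Complex.norm_real, Real.norm_eq_abs,
    sq_abs]

/-- **THE DIRICHLET ENERGY IS THE SHIFTED FORM OF THE IMAGINARY TEST VECTOR** (`L ≥ 3`): for a Perron sector
amplitude `a` (sector `M`, energy `E₀`) and real `g`, with `φ = i g a`,
`Re⟨φ, (H − E₀) φ⟩ = Q(a; g)` (ground-state transform + bonds = edges). [folklore] -/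
theorem dirichlet_eq_shiftedForm (hL : 3 ≤ L) (Δ M : ℝ) (a : TensorIndex (TorusSite 2 L) 2 → ℝ)
    (ha : IsPerronSectorGroundAmplitude L Δ M a) (g : TensorIndex (TorusSite 2 L) 2 → ℝ) :
    (star (fun σ => I * (g σ : ℂ) * (a σ : ℂ)) ⬝ᵥ ((hcbHamiltonian L Δ
        - ((lowestEnergyInSector 1 (hcbHamiltonian L Δ) M : ℝ) : ℂ) • (1 : Op (TorusSite 2 L) 2)) *ᵥ
          (fun σ => I * (g σ : ℂ) * (a σ : ℂ)))).re
      = dirichletEnergy a g := by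
  set E₀ : ℝ := lowestEnergyInSector 1 (hcbHamiltonian L Δ) M with hE₀
  set φ : TensorIndex (TorusSite 2 L) 2 → ℂ := fun σ => I * (g σ : ℂ) * (a σ : ℂ) with hφ
  set u : TensorIndex (TorusSite 2 L) 2 → ℂ := fun σ => I * (g σ : ℂ) with hu
  have hφu : ∀ σ, φ σ = u σ * (a σ : ℂ) := fun σ => rfl
  set G : Sym2 (TorusSite 2 L) → ℝ := Sym2.lift ⟨fun x y => (1 / 4 : ℝ) *
      ∑ σ : TensorIndex (TorusSite 2 L) 2, (if σ x ≠ σ y then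
        a σ * a (σ ∘ Equiv.swap x y) * ‖u σ - u (σ ∘ Equiv.swap x y)‖ ^ 2 else 0),
      fun x y => by simp only [ne_comm, Equiv.swap_comm]⟩ with hG
  have hq : (star φ ⬝ᵥ ((hcbHamiltonian L Δ - ((E₀ : ℝ) : ℂ) • (1 : Op (TorusSite 2 L) 2)) *ᵥ φ)).re
      = ∑ e ∈ (torusGraph 2 L).edgeFinset, G e := by
    rw [shiftedForm_re, hG]
    exact xxz_groundStateTransform (torusGraph 2 L) Δ a E₀ ha.eigen u φ hφu
  rw [hq, ← sum_bond_eq_sum_edge hL G]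
  refine Finset.sum_congr rfl fun p _ => ?_
  show G _ = bondDirichlet a _ _ g
  rw [hG, Sym2.lift_mk]
  unfold bondDirichlet
  refine congrArg (fun z : ℝ => (1 / 4 : ℝ) * z) ?_
  refine Finset.sum_congr rfl fun σ _ => ?_
  split_ifs
  · simp only [hu, norm_I_mul_sub_sq]
  · rfl

/-! ## D. The current form of the imaginary test vector is the winding pairing -/

/-- **`⟨i g ψ, J^j_0 ψ⟩ = −i B_j(g)`** (`L ≥ 2`; `bondCurrentForm_symm` per bond, zero momentum). [folklore] -/
theorem currentForm_eq_pairing (hL : 2 ≤ L) (a g : TensorIndex (TorusSite 2 L) 2 → ℝ) (j : Fin 2) :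
    star (fun σ => I * (g σ : ℂ) * (a σ : ℂ)) ⬝ᵥ (currentMode L 0 j *ᵥ toC L a)
      = -I * (windingPairing a j g : ℂ) := by
  set φ : TensorIndex (TorusSite 2 L) 2 → ℂ := fun σ => I * (g σ : ℂ) * (a σ : ℂ) with hφ
  set u : TensorIndex (TorusSite 2 L) 2 → ℂ := fun σ => I * (g σ : ℂ) with hu
  have hφu : ∀ σ, φ σ = u σ * (a σ : ℂ) := fun σ => rfl
  have hconj : ∀ τ, conj (u τ) = -I * (g τ : ℂ) := by
    intro τ
    simp only [hu, map_mul, Complex.conj_I, Complex.conj_ofReal]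
  unfold currentMode windingPairing
  rw [Matrix.sum_mulVec, dotProduct_sum, Complex.ofReal_sum, Finset.mul_sum]
  refine Finset.sum_congr rfl fun x _ => ?_
  have hxy : x ≠ x + Pi.single j 1 := Ne.symm (add_single_ne_self hL x j)
  rw [Matrix.smul_mulVec, dotProduct_smul, smul_eq_mul,
    Summit.HubbardSuperconductivity.HubbardSuperconductivity.Theorems.AnisotropyChord.InsertionEntropy.torusPhase_zero_left,
    one_mul]
  unfold toC
  rw [bondCurrentForm_symm hxy a u φ hφu]
  unfold bondPairing
  rw [Complex.ofReal_mul, Complex.ofReal_sum, Finset.mul_sum, Finset.mul_sum, Finset.mul_sum]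
  refine Finset.sum_congr rfl fun σ _ => ?_
  rw [hconj, hconj]
  unfold orient
  have fin2 : ∀ t : Fin 2, t = 0 ∨ t = 1 := by decide
  rcases fin2 (σ x) with hx | hx <;> rcases fin2 (σ (x + Pi.single j 1)) with hy | hy <;>
    simp [hx, hy] <;> ring

/-- The imaginary test vector `i g ψ` lies in the sector of `ψ` (same support). [folklore] -/
theorem imagTest_mem_spinZSector (M : ℝ) (a : TensorIndex (TorusSite 2 L) 2 → ℝ)
    (ha : (fun σ => (a σ : ℂ)) ∈ spinZSector (Λ := TorusSite 2 L) 1 M) (g : TensorIndex (TorusSite 2 L) 2 → ℝ) :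
    (fun σ => I * (g σ : ℂ) * (a σ : ℂ)) ∈ spinZSector (Λ := TorusSite 2 L) 1 M := by
  rw [LiebMattis.mem_spinZSector_iff] at ha ⊢
  intro σ hσ
  apply ha σ
  intro h0
  apply hσ
  show I * (g σ : ℂ) * (a σ : ℂ) = 0
  rw [h0, mul_zero]

/-- The Dirichlet energy is non-negative for `a ≥ 0`. [folklore] -/
theorem dirichletEnergy_nonneg (a : TensorIndex (TorusSite 2 L) 2 → ℝ) (ha : ∀ σ, 0 ≤ a σ)
    (g : TensorIndex (TorusSite 2 L) 2 → ℝ) : 0 ≤ dirichletEnergy a g := by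
  unfold dirichletEnergy bondDirichlet
  refine Finset.sum_nonneg fun p _ => mul_nonneg (by norm_num) (Finset.sum_nonneg fun σ _ => ?_)
  split_ifs
  · exact mul_nonneg (mul_nonneg (ha _) (ha _)) (sq_nonneg _)
  · exact le_rfl

/-! ## E. THE THEOREM: φ-form twist stiffness ⇒ winding-energy floor for every real potential -/

/-- **WINDING-ENERGY FLOOR (fixed `L ≥ 3`, any sector label).**  If `Υ ≤ ⟨−T_j⟩` and every sector test
vector `φ` obeys `2|⟨φ, J^j_0 ψ⟩|² ≤ (⟨−T_j⟩ − Υ) Re⟨φ, (H − E₀)φ⟩` (the φ-form of `Υ^j L² ≥ Υ`, i.e.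
`2 m₋₁(J^j_0) ≤ ⟨−T_j⟩ − Υ`), then `Υ/2 ≤ W_j(a; g)` for every real `g`: testing with `φ = i g ψ` gives
`2B² ≤ (K − Υ)Q`, and `W = Q + 2B + K/2 ≥ K/2 − (K − Υ)/2`. [folklore] -/
theorem windingEnergy_ge (hL : 3 ≤ L) (Δ M : ℝ) (a : TensorIndex (TorusSite 2 L) 2 → ℝ)
    (ha : IsPerronSectorGroundAmplitude L Δ M a) (j : Fin 2) (Υ : ℝ) (hK : Υ ≤ kineticExpect L a j)
    (hvar : ∀ φ : TensorIndex (TorusSite 2 L) 2 → ℂ, φ ∈ spinZSector (Λ := TorusSite 2 L) 1 M →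
      2 * ‖star φ ⬝ᵥ (currentMode L 0 j *ᵥ toC L a)‖ ^ 2
        ≤ (kineticExpect L a j - Υ) * (star φ ⬝ᵥ ((hcbHamiltonian L Δ
              - ((lowestEnergyInSector 1 (hcbHamiltonian L Δ) M : ℝ) : ℂ) • (1 : Op (TorusSite 2 L) 2)) *ᵥ φ)).re)
    (g : TensorIndex (TorusSite 2 L) 2 → ℝ) : Υ / 2 ≤ windingEnergy a j g := by
  have h2 := hvar (fun σ => I * (g σ : ℂ) * (a σ : ℂ)) (imagTest_mem_spinZSector M a ha.sector g)
  rw [currentForm_eq_pairing (by omega) a g j, dirichlet_eq_shiftedForm hL Δ M a ha g] at h2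
  have hnorm : ‖-I * (windingPairing a j g : ℂ)‖ ^ 2 = windingPairing a j g ^ 2 := by
    rw [norm_mul, norm_neg, Complex.norm_I, one_mul, Complex.norm_real, Real.norm_eq_abs, sq_abs]
  rw [hnorm] at h2
  rw [windingEnergy_expand (by omega) a j g]
  have hQ := dirichletEnergy_nonneg a ha.nonneg g
  set Q := dirichletEnergy a g
  set B := windingPairing a j g
  set K := kineticExpect L a j
  by_contra hcon
  push Not at hcon
  have h3 : 0 < Q + (K - Υ) / 2 - 2 * B := by linarith
  have h4 : 0 < -(Q + (K - Υ) / 2 + 2 * B) := by linarith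
  nlinarith [mul_pos h3 h4, h2, sq_nonneg (Q - (K - Υ) / 2), hQ]

/-- **(S_tw) φ-form ⇒ (S_tw) network form: `VariationalTwistStiffness Δ M → DoobWindingStiffness Δ M`.**
The twist stiffness hypothesis of H0 says exactly that the Doob configuration network of the reference
amplitude has winding conductance `≥ ½Υ₀L²` on both axes. [folklore] -/
theorem doobWindingStiffness_of_variational (Δ : ℝ) (M : ℕ → ℝ) (h : VariationalTwistStiffness Δ M) :
    DoobWindingStiffness Δ M := by
  obtain ⟨Υ₀, hΥ₀, hev⟩ := h
  refine ⟨Υ₀, hΥ₀, ?_⟩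
  filter_upwards [hev, eventually_ge_atTop 3] with L hL h3
  intro _ a ha j g
  obtain ⟨hK, hvar⟩ := hL a ha j
  exact windingEnergy_ge h3 Δ (M L - 1) a ha j (Υ₀ * (L : ℝ) ^ 2) hK hvar g

/-- The `N`-sector twin: `VariationalTwistStiffnessN Δ M → DoobWindingStiffnessN Δ M`. [folklore] -/
theorem doobWindingStiffnessN_of_variationalN (Δ : ℝ) (M : ℕ → ℝ) (h : VariationalTwistStiffnessN Δ M) :
    DoobWindingStiffnessN Δ M := by
  obtain ⟨Υ₀, hΥ₀, hev⟩ := h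
  refine ⟨Υ₀, hΥ₀, ?_⟩
  filter_upwards [hev, eventually_ge_atTop 3] with L hL h3
  intro _ a ha j g
  obtain ⟨hK, hvar⟩ := hL a ha j
  exact windingEnergy_ge h3 Δ (M L) a ha j (Υ₀ * (L : ℝ) ^ 2) hK hvar g

end Summit.HubbardSuperconductivity.HubbardSuperconductivity.Theorems.AnisotropyChord.Stiffness.Doob
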